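import Summits.BirchSwinnertonDyer.BirchSwinnertonDyer.Theorems.PrintCf2SplitBadTwoLineDoubleCosetPlaces
import HarnessLib

/-!
# Crux `PrintCf2.SplitBadTwoRankOneOfFacts` (stmt-BirchSwinnertonDyer-20368), road α v13 — (DC) part 4b:
# THE MIRRORED INDEX SET `D_w \ Γ_K / ker κ` (decomposition group on the LEFT, the line's kernel on the RIGHT) — R3's orientation

Cell `bsd-print-cf2`, EXTRA WIDTH seat `bsd-line-cf2-p1-w8` g4 (prover-bsd-line-cf2-p1-w8-g4-0); answers -w4 g12 05:02:06Z «index set per place w is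
'DoubleCoset.Quotient ↑(decomp w) ↑κ₂.kerSubgroup' (decomp on the LEFT, the line's kernel on the RIGHT: the class of σ = {d σ g} is the place of K*_∞
read through conj_σ at the chosen w̃₀) … add the mirrored 'finite_doubleCosetQuotient' with the subgroups swapped» and -w2 g14 05:07:37Z (R2's target
family is indexed by the same type). `--supports stmt-BirchSwinnertonDyer-20368` (helper, Theses-free). HONEST FRAMING: pure group theory plus the two
tree inputs of part 4; nothing here closes the crux or a registered stub; BSD is not proved by any of this; no `sorry`, no new axiom, no fact, no definition.

Content = part 4 (`…LineDoubleCosetPlaces`, §1–§4) with the two subgroups SWAPPED: every `σ ∈ Γ_K` is `τ · γⁿ · h` (`τ ∈ S`, `n < p^m`, `h ∈ ker κ`),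
so `n ↦ S · γⁿ · ker κ` maps `{n < p^m}` onto `S \ Γ_K / ker κ` (injectively when `κ(S) = p^m ℤ_p`): `finite_doubleCosetQuotient'`,
`natCard_doubleCosetQuotient_le'` / `_eq'`, `natCard_doubleCosetQuotient_swap` (same count as the other orientation), `subsingleton_doubleCosetQuotient_of_isUnit'`;
places `…_decomp_of_not_le'` / `_of_isUnit'`; line `finite_doubleCosetQuotient_decomp_of_line'` (`w ≠ v̄`, `W`-free); frame `…_vbar_of_frame'` (singleton),
`finite_doubleCosetQuotient_decomp_of_frame'` (every `w`); §2 (appended) `W`-FREE forms: `decomp_not_le_kerSubgroup_of_isUnramifiedOutside'` (EVERY `w`,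
also `v̄`), `finite_doubleCosetQuotient_decomp_of_line_all'` / `_all` (both orientations), `…_vbar_of_isUnramifiedOutside`, the `p`-power count.
[cite: NeukirchANT1999, Ch. I §9 p. 54] [cite: Washington1997, §13.1–13.2] [cite: GreenbergVatsal2000, §2 Prop. 2.1 pp. 17–21]
-/

noncomputable section

set_option linter.dupNamespace false
set_option autoImplicit false

open scoped Classical

open NumberField IsDedekindDomain Field WeierstrassCurve
open Literature.NumberTheory.EllipticCurves Literature.NumberTheory.EllipticCurves.GreenbergSelmer
open Literature.NumberTheory.GaloisRepresentations
open Summit.BirchSwinnertonDyer.BirchSwinnertonDyer.Theorems.AnomalousLocalTorsion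

namespace Summit.BirchSwinnertonDyer.BirchSwinnertonDyer.Theorems.PrintCf2.LineDoubleCoset


/-! ## §1. The MIRRORED orientation `S \ Γ_K / ker κ` (decomposition group on the LEFT, the line's kernel on the RIGHT) — R3's index set
(-w4 g12 05:02:06Z: «'DoubleCoset.Quotient ↑(decomp w) ↑κ₂.kerSubgroup' … the class of σ = {d σ g} is the place of K*_∞ read through conj_σ») -/

section Mirror

variable {K : Type} [Field K] [NumberField K] {p : ℕ} [Fact p.Prime] (κ : ZpExtension K p)

/-- **Every `σ ∈ Γ_K` is `τ · γⁿ · h` with `τ ∈ S`, `n < p^m`, `h ∈ ker κ`** (closed `S ∋ τ₁`, `κ τ₁ ≠ 1` of valuation `m`, `γ` a topological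
generator) — part 1's (DC-1) for an arbitrary closed `S` in place of `I_w`. [cite: Washington1997, §13.1–13.2] [cite: NeukirchANT1999, Ch. I §9 p. 54] -/
theorem exists_eq_mem_mul_pow_mul_kerSubgroup (S : Subgroup (absoluteGaloisGroup K)) (hS : IsClosed (S : Set (absoluteGaloisGroup K)))
    {τ₁ : absoluteGaloisGroup K} (hτ₁ : τ₁ ∈ S) (hne : κ τ₁ ≠ 1) {γ : absoluteGaloisGroup K} (hγ : κ.IsTopGenerator γ)
    (σ : absoluteGaloisGroup K) :
    ∃ (τ : absoluteGaloisGroup K) (n : ℕ) (h : absoluteGaloisGroup K),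
      τ ∈ S ∧ n < p ^ ((κ τ₁).toAdd).valuation ∧ h ∈ κ.kerSubgroup ∧ σ = τ * γ ^ n * h := by
  set m : ℕ := ((κ τ₁).toAdd).valuation with hm
  set a : ℤ_[p] := (κ σ).toAdd with ha
  have hdvd : (p : ℤ_[p]) ^ m ∣ a - (PadicInt.appr a m : ℤ_[p]) := Ideal.mem_span_singleton.mp (PadicInt.appr_spec m a)
  obtain ⟨τ, hτS, hτ⟩ := exists_mem_apply_toAdd_eq_of_dvd κ S hS hτ₁ hne hdvd
  refine ⟨τ, PadicInt.appr a m, (τ * γ ^ PadicInt.appr a m)⁻¹ * σ, hτS, PadicInt.appr_lt a m, ?_, by group⟩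
  rw [ZpExtension.mem_kerSubgroup, map_mul, map_inv, map_mul, map_pow, hγ]
  apply Multiplicative.toAdd.injective
  rw [toAdd_mul, toAdd_inv, toAdd_mul, toAdd_pow, toAdd_ofAdd, hτ, toAdd_one, ← ha]
  simp only [nsmul_eq_mul, mul_one]
  ring

/-- **Mirrored: the double coset `S · σ · ker κ` is `S · γⁿ · ker κ` for some `n < p^m`.** [cite: NeukirchANT1999, Ch. I §9 p. 54] -/
theorem exists_lt_doubleCoset_mk_eq' (S : Subgroup (absoluteGaloisGroup K)) (hS : IsClosed (S : Set (absoluteGaloisGroup K)))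
    {τ₁ : absoluteGaloisGroup K} (hτ₁ : τ₁ ∈ S) (hne : κ τ₁ ≠ 1) {γ : absoluteGaloisGroup K} (hγ : κ.IsTopGenerator γ)
    (σ : absoluteGaloisGroup K) :
    ∃ n < p ^ ((κ τ₁).toAdd).valuation, DoubleCoset.mk S κ.kerSubgroup σ = DoubleCoset.mk S κ.kerSubgroup (γ ^ n) := by
  obtain ⟨τ, n, h, hτ, hn, hh, hσ⟩ := exists_eq_mem_mul_pow_mul_kerSubgroup κ S hS hτ₁ hne hγ σ
  exact ⟨n, hn, ((DoubleCoset.eq S κ.kerSubgroup (γ ^ n) σ).mpr ⟨τ, hτ, h, hh, hσ⟩).symm⟩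

/-- **Mirrored: `n ↦ S · γⁿ · ker κ` maps `{n < p^m}` ONTO `S \ Γ_K / ker κ`.** [cite: NeukirchANT1999, Ch. I §9 p. 54] -/
theorem doubleCoset_mk_pow_surjective' (S : Subgroup (absoluteGaloisGroup K)) (hS : IsClosed (S : Set (absoluteGaloisGroup K)))
    {τ₁ : absoluteGaloisGroup K} (hτ₁ : τ₁ ∈ S) (hne : κ τ₁ ≠ 1) {γ : absoluteGaloisGroup K} (hγ : κ.IsTopGenerator γ) :
    Function.Surjective (fun n : Fin (p ^ ((κ τ₁).toAdd).valuation) ↦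
      (DoubleCoset.mk S κ.kerSubgroup (γ ^ (n : ℕ)) : DoubleCoset.Quotient (S : Set (absoluteGaloisGroup K)) κ.kerSubgroup)) := by
  intro q
  induction q using Quotient.inductionOn' with
  | h σ =>
    obtain ⟨n, hn, hq⟩ := exists_lt_doubleCoset_mk_eq' κ S hS hτ₁ hne hγ σ
    exact ⟨⟨n, hn⟩, hq.symm⟩

omit [NumberField K] in
/-- **Mirrored: `n ↦ S · γⁿ · ker κ` is INJECTIVE on `{n < p^m}` when `p^m ∣ κ τ` for all `τ ∈ S`.** [cite: NeukirchANT1999, Ch. I §9 p. 54] -/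
theorem doubleCoset_mk_pow_injective' (S : Subgroup (absoluteGaloisGroup K)) {τ₁ : absoluteGaloisGroup K}
    (hmin : ∀ τ ∈ S, (p : ℤ_[p]) ^ ((κ τ₁).toAdd).valuation ∣ (κ τ).toAdd) {γ : absoluteGaloisGroup K} (hγ : κ.IsTopGenerator γ) :
    Function.Injective (fun n : Fin (p ^ ((κ τ₁).toAdd).valuation) ↦
      (DoubleCoset.mk S κ.kerSubgroup (γ ^ (n : ℕ)) : DoubleCoset.Quotient (S : Set (absoluteGaloisGroup K)) κ.kerSubgroup)) := by
  set m : ℕ := ((κ τ₁).toAdd).valuation with hm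
  intro a b hab
  obtain ⟨τ, hτ, h, hh, heq⟩ := (DoubleCoset.eq S κ.kerSubgroup (γ ^ (a : ℕ)) (γ ^ (b : ℕ))).mp hab
  have hγ' : κ γ = Multiplicative.ofAdd 1 := hγ
  have hκ := congrArg (fun g ↦ (κ g).toAdd) heq
  simp only [map_mul, map_pow, hγ', toAdd_mul, toAdd_pow, toAdd_ofAdd, nsmul_eq_mul, mul_one,
    (ZpExtension.mem_kerSubgroup ..).mp hh] at hκ
  -- `hκ : (b : ℤ_[p]) = (κ τ).toAdd + a` (up to the trivial `toAdd 1` summand handled by `push_cast`/`ring` below)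
  have hdvd : (p : ℤ_[p]) ^ m ∣ (((b : ℕ) : ℤ) - ((a : ℕ) : ℤ) : ℤ) := by
    have h1 : (((b : ℕ) : ℤ) - ((a : ℕ) : ℤ) : ℤ) = ((κ τ).toAdd : ℤ_[p]) := by
      push_cast
      rw [hκ]
      ring
    rw [h1]
    exact hmin τ hτ
  have hdvdZ : ((p : ℤ) ^ m) ∣ ((b : ℕ) : ℤ) - ((a : ℕ) : ℤ) :=
    PadicInt.norm_int_le_pow_iff_dvd.mp
      ((PadicInt.norm_le_pow_iff_mem_span_pow _ _).mpr (Ideal.mem_span_singleton.mpr hdvd))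
  have hmod : (a : ℕ) ≡ (b : ℕ) [MOD p ^ m] := Nat.modEq_iff_dvd.mpr (by exact_mod_cast hdvdZ)
  exact Fin.ext (hmod.eq_of_lt_of_lt a.2 b.2)

/-- **Mirrored: `S \ Γ_K / ker κ` is FINITE** (closed `S` on which `κ` is non-trivial) — the finiteness of R3's index set of the places of `K_∞`
above `w` for `S = D_w`. [cite: NeukirchANT1999, Ch. I §9 p. 54] [cite: Washington1997, §13.1] -/
theorem finite_doubleCosetQuotient' (S : Subgroup (absoluteGaloisGroup K)) (hS : IsClosed (S : Set (absoluteGaloisGroup K)))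
    {τ₁ : absoluteGaloisGroup K} (hτ₁ : τ₁ ∈ S) (hne : κ τ₁ ≠ 1) :
    Finite (DoubleCoset.Quotient (S : Set (absoluteGaloisGroup K)) κ.kerSubgroup) := by
  obtain ⟨γ, hγ⟩ := κ.surjective (Multiplicative.ofAdd 1)
  exact Finite.of_surjective _ (doubleCoset_mk_pow_surjective' κ S hS hτ₁ hne hγ)

/-- **Mirrored: `#(S \ Γ_K / ker κ) ≤ p^m`.** [cite: NeukirchANT1999, Ch. I §9 p. 54] -/
theorem natCard_doubleCosetQuotient_le' (S : Subgroup (absoluteGaloisGroup K)) (hS : IsClosed (S : Set (absoluteGaloisGroup K)))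
    {τ₁ : absoluteGaloisGroup K} (hτ₁ : τ₁ ∈ S) (hne : κ τ₁ ≠ 1) :
    Nat.card (DoubleCoset.Quotient (S : Set (absoluteGaloisGroup K)) κ.kerSubgroup) ≤ p ^ ((κ τ₁).toAdd).valuation := by
  obtain ⟨γ, hγ⟩ := κ.surjective (Multiplicative.ofAdd 1)
  simpa only [Nat.card_eq_fintype_card, Fintype.card_fin] using
    Nat.card_le_card_of_surjective _ (doubleCoset_mk_pow_surjective' κ S hS hτ₁ hne hγ)

/-- **Mirrored: `#(S \ Γ_K / ker κ) = p^m`** when `κ(S) = p^m ℤ_p`. [cite: NeukirchANT1999, Ch. I §9 p. 54] -/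
theorem natCard_doubleCosetQuotient_eq' (S : Subgroup (absoluteGaloisGroup K)) (hS : IsClosed (S : Set (absoluteGaloisGroup K)))
    {τ₁ : absoluteGaloisGroup K} (hτ₁ : τ₁ ∈ S) (hne : κ τ₁ ≠ 1)
    (hmin : ∀ τ ∈ S, (p : ℤ_[p]) ^ ((κ τ₁).toAdd).valuation ∣ (κ τ).toAdd) :
    Nat.card (DoubleCoset.Quotient (S : Set (absoluteGaloisGroup K)) κ.kerSubgroup) = p ^ ((κ τ₁).toAdd).valuation := by
  obtain ⟨γ, hγ⟩ := κ.surjective (Multiplicative.ofAdd 1)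
  rw [← Nat.card_eq_of_bijective _ ⟨doubleCoset_mk_pow_injective' κ S hmin hγ, doubleCoset_mk_pow_surjective' κ S hS hτ₁ hne hγ⟩,
    Nat.card_eq_fintype_card, Fintype.card_fin]

/-- **Mirrored: the two orientations have the same cardinality** `#(S \ Γ_K / ker κ) = #(ker κ \ Γ_K / S)` (both `= p^m` for the minimal valuation `m`).
[cite: NeukirchANT1999, Ch. I §9 p. 54] -/
theorem natCard_doubleCosetQuotient_swap (S : Subgroup (absoluteGaloisGroup K)) (hS : IsClosed (S : Set (absoluteGaloisGroup K)))
    (hD : ¬ S ≤ κ.kerSubgroup) :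
    Nat.card (DoubleCoset.Quotient (S : Set (absoluteGaloisGroup K)) κ.kerSubgroup) =
      Nat.card (DoubleCoset.Quotient (κ.kerSubgroup : Set (absoluteGaloisGroup K)) S) := by
  obtain ⟨τ₀, hτ₀, hnot⟩ := SetLike.not_le_iff_exists.mp hD
  obtain ⟨τ₁, hτ₁, hne, hmin⟩ := exists_mem_minimal_valuation κ S hτ₀ (fun h ↦ hnot (by rwa [ZpExtension.mem_kerSubgroup]))
  rw [natCard_doubleCosetQuotient_eq' κ S hS hτ₁ hne hmin, natCard_doubleCosetQuotient_eq κ S hS hτ₁ hne hmin]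

/-- **Mirrored: `S \ Γ_K / ker κ` is a SINGLETON when `κ τ₁` is a unit for some `τ₁ ∈ S`** (`Γ_K = S · ker κ`). [cite: NeukirchANT1999, Ch. I §9 p. 54] -/
theorem subsingleton_doubleCosetQuotient_of_isUnit' (S : Subgroup (absoluteGaloisGroup K)) (hS : IsClosed (S : Set (absoluteGaloisGroup K)))
    {τ₁ : absoluteGaloisGroup K} (hτ₁ : τ₁ ∈ S) (hu : IsUnit (κ τ₁).toAdd) :
    Subsingleton (DoubleCoset.Quotient (S : Set (absoluteGaloisGroup K)) κ.kerSubgroup) := by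
  obtain ⟨u, hu⟩ := hu
  have key : ∀ σ : absoluteGaloisGroup K,
      (DoubleCoset.mk S κ.kerSubgroup σ : DoubleCoset.Quotient (S : Set (absoluteGaloisGroup K)) κ.kerSubgroup) =
        DoubleCoset.mk S κ.kerSubgroup 1 := by
    intro σ
    obtain ⟨τ, hτS, hτ⟩ := exists_mem_apply_eq_ofAdd_mul κ S hS hτ₁ ((κ σ).toAdd * ((u⁻¹ : ℤ_[p]ˣ) : ℤ_[p]))
    refine ((DoubleCoset.eq S κ.kerSubgroup 1 σ).mpr ⟨τ, hτS, τ⁻¹ * σ, ?_, by group⟩).symm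
    rw [ZpExtension.mem_kerSubgroup, map_mul, map_inv, hτ, ← hu, mul_assoc, Units.inv_mul, mul_one, ofAdd_toAdd, inv_mul_cancel]
  constructor
  intro a b
  induction a using Quotient.inductionOn' with
  | h σ =>
    induction b using Quotient.inductionOn' with
    | h σ' =>
      change DoubleCoset.mk S κ.kerSubgroup σ = DoubleCoset.mk S κ.kerSubgroup σ'
      rw [key σ, key σ']

/-- **Mirrored, places: `D_w \ Γ_K / ker κ` is finite if `w` does not split completely in `K_∞`.** [cite: NeukirchANT1999, Ch. I §9 p. 54] -/
theorem finite_doubleCosetQuotient_decomp_of_not_le' {w : HeightOneSpectrum (𝓞 K)} (hD : ¬ GreenbergSelmer.decomp w ≤ κ.kerSubgroup) :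
    Finite (DoubleCoset.Quotient (GreenbergSelmer.decomp w : Set (absoluteGaloisGroup K)) κ.kerSubgroup) := by
  obtain ⟨τ₁, hτ₁, hnot⟩ := SetLike.not_le_iff_exists.mp hD
  exact finite_doubleCosetQuotient' κ (GreenbergSelmer.decomp w) (isClosed_decomp w) hτ₁
    (fun h ↦ hnot (by rwa [ZpExtension.mem_kerSubgroup]))

/-- **Mirrored, places: `D_w \ Γ_K / ker κ` is a singleton if `κ` takes a unit value on `I_w`.** [cite: NeukirchANT1999, Ch. I §9 p. 54] -/
theorem subsingleton_doubleCosetQuotient_decomp_of_isUnit' {w : HeightOneSpectrum (𝓞 K)} {τ₁ : absoluteGaloisGroup K}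
    (hτ₁ : τ₁ ∈ GreenbergSelmer.inertia w) (hu : IsUnit (κ τ₁).toAdd) :
    Subsingleton (DoubleCoset.Quotient (GreenbergSelmer.decomp w : Set (absoluteGaloisGroup K)) κ.kerSubgroup) :=
  subsingleton_doubleCosetQuotient_of_isUnit' κ (GreenbergSelmer.decomp w) (isClosed_decomp w)
    (GreenbergSelmer.inertia_le_decomp w hτ₁) hu

end Mirror

section MirrorFrame

variable {K : Type} [Field K] [NumberField K]

/-- **Mirrored, the line: for `κ` unramified outside `v̄` over an imaginary quadratic `K` with `p = v v̄`, `D_w \ Γ_K / ker κ` is FINITE for every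
`w ≠ v̄`** (`W`-free; -w8 g2's no-split) — R3's index set above `w ∈ T`. [cite: NeukirchANT1999, Ch. I §9 p. 54] [cite: deShalit1987, II §1.9] -/
theorem finite_doubleCosetQuotient_decomp_of_line' {p : ℕ} [Fact p.Prime] (hK : IsImaginaryQuadratic K)
    {v vbar : HeightOneSpectrum (𝓞 K)} (hv : ((p : ℕ) : 𝓞 K) ∈ v.asIdeal) (hvbar : ((p : ℕ) : 𝓞 K) ∈ vbar.asIdeal) (hne : vbar ≠ v)
    (κ : ZpExtension K p) (hκ : κ.IsUnramifiedOutside vbar) {w : HeightOneSpectrum (𝓞 K)} (hw : w ≠ vbar) :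
    Finite (DoubleCoset.Quotient (GreenbergSelmer.decomp w : Set (absoluteGaloisGroup K)) κ.kerSubgroup) :=
  finite_doubleCosetQuotient_decomp_of_not_le' κ
    (LineDecomposition.decomp_not_le_kerSubgroup_of_isUnramifiedOutside hK hv hvbar hne κ hκ hw)

/-- **Mirrored, frame: `D_v̄ \ Γ_K / ker κ'` is a SINGLETON on a road-α frame** (one place of `K*_∞` above `v̄`). [cite: NeukirchANT1999, Ch. I §9 p. 54] -/
theorem subsingleton_doubleCosetQuotient_decomp_vbar_of_frame' {d : ℤ} (hd0 : d ≠ 0) (W : WeierstrassCurve ℚ) [W.IsElliptic]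
    (C : VariableChange ℚ) (hC : C • W = cm7.quadraticTwist (d : ℚ)) (hK : IsImaginaryQuadratic K)
    {v vbar : HeightOneSpectrum (𝓞 K)} (hv : ((2 : ℕ) : 𝓞 K) ∈ v.asIdeal) (hvbar : ((2 : ℕ) : 𝓞 K) ∈ vbar.asIdeal) (hne : vbar ≠ v)
    (π : (W.baseChange K).endRing) (hrel : (π : AddMonoid.End (W.baseChange K).geomPoints) * π = π - 2)
    (κ' : ZpExtension K 2) (hκ' : κ'.IsUnramifiedOutside vbar) :
    Subsingleton (DoubleCoset.Quotient (GreenbergSelmer.decomp vbar : Set (absoluteGaloisGroup K)) κ'.kerSubgroup) := by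
  haveI : Fact (Nat.Prime 2) := ⟨Nat.prime_two⟩
  obtain ⟨τ₁, hτ₁, hu⟩ := exists_mem_inertia_isUnit_of_frame hd0 W C hC hK hv hvbar hne π hrel κ' hκ'
  exact subsingleton_doubleCosetQuotient_decomp_of_isUnit' κ' hτ₁ hu

/-- **Mirrored, frame: `D_w \ Γ_K / ker κ'` is FINITE for EVERY place `w` of `K` on a road-α frame.** [cite: NeukirchANT1999, Ch. I §9 p. 54] -/
theorem finite_doubleCosetQuotient_decomp_of_frame' {d : ℤ} (hd0 : d ≠ 0) (W : WeierstrassCurve ℚ) [W.IsElliptic]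
    (C : VariableChange ℚ) (hC : C • W = cm7.quadraticTwist (d : ℚ)) (hK : IsImaginaryQuadratic K)
    {v vbar : HeightOneSpectrum (𝓞 K)} (hv : ((2 : ℕ) : 𝓞 K) ∈ v.asIdeal) (hvbar : ((2 : ℕ) : 𝓞 K) ∈ vbar.asIdeal) (hne : vbar ≠ v)
    (π : (W.baseChange K).endRing) (hrel : (π : AddMonoid.End (W.baseChange K).geomPoints) * π = π - 2)
    (κ' : ZpExtension K 2) (hκ' : κ'.IsUnramifiedOutside vbar) (w : HeightOneSpectrum (𝓞 K)) :
    Finite (DoubleCoset.Quotient (GreenbergSelmer.decomp w : Set (absoluteGaloisGroup K)) κ'.kerSubgroup) := by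
  haveI : Fact (Nat.Prime 2) := ⟨Nat.prime_two⟩
  by_cases hw : w = vbar
  · subst hw
    haveI := subsingleton_doubleCosetQuotient_decomp_vbar_of_frame' hd0 W C hC hK hv hvbar hne π hrel κ' hκ'
    infer_instance
  · exact finite_doubleCosetQuotient_decomp_of_line' hK hv hvbar hne κ' hκ' hw

end MirrorFrame

/-! ## §2. `W`-FREE: on the `v̄`-line EVERY place of `K` has finitely many places above it (also `v̄` itself) -/

section LineAll

variable {K : Type} [Field K] [NumberField K]

/-- **`W`-free, at `v̄` itself**: for a `ℤ_p`-line `κ` of an imaginary quadratic `K` unramified outside `v̄`, `D_v̄ ⊄ ker κ` — indeed `I_v̄ ⊄ ker κ`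
(part 2 `exists_mem_inertia_apply_ne_one_of_isUnramifiedOutside`: a non-trivial `ℤ_p`-extension is ramified somewhere above `p`, and by hypothesis
nowhere but `v̄`) — so `D_v̄ \ Γ_K / ker κ` is FINITE. [cite: Lang1990, Ch. 5 §5, Thm. 5.1] [cite: NeukirchANT1999, Ch. I §9 p. 54] -/
theorem finite_doubleCosetQuotient_decomp_vbar_of_isUnramifiedOutside' {p : ℕ} [Fact p.Prime] (hK : IsImaginaryQuadratic K)
    {vbar : HeightOneSpectrum (𝓞 K)} (κ : ZpExtension K p) (hκ : κ.IsUnramifiedOutside vbar) :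
    Finite (DoubleCoset.Quotient (GreenbergSelmer.decomp vbar : Set (absoluteGaloisGroup K)) κ.kerSubgroup) := by
  obtain ⟨τ₁, hτ₁, hne⟩ := exists_mem_inertia_apply_ne_one_of_isUnramifiedOutside hK κ hκ
  exact finite_doubleCosetQuotient' κ (GreenbergSelmer.decomp vbar) (isClosed_decomp vbar)
    (GreenbergSelmer.inertia_le_decomp vbar hτ₁) hne

/-- **`W`-free, the other orientation at `v̄`**: `ker κ \ Γ_K / D_v̄` is finite. [cite: NeukirchANT1999, Ch. I §9 p. 54] -/
theorem finite_doubleCosetQuotient_decomp_vbar_of_isUnramifiedOutside {p : ℕ} [Fact p.Prime] (hK : IsImaginaryQuadratic K)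
    {vbar : HeightOneSpectrum (𝓞 K)} (κ : ZpExtension K p) (hκ : κ.IsUnramifiedOutside vbar) :
    Finite (DoubleCoset.Quotient (κ.kerSubgroup : Set (absoluteGaloisGroup K)) (GreenbergSelmer.decomp vbar)) := by
  obtain ⟨τ₁, hτ₁, hne⟩ := exists_mem_inertia_apply_ne_one_of_isUnramifiedOutside hK κ hκ
  exact finite_doubleCosetQuotient κ (GreenbergSelmer.decomp vbar) (isClosed_decomp vbar)
    (GreenbergSelmer.inertia_le_decomp vbar hτ₁) hne

/-- **`W`-free: NO place of `K` splits completely in the `v̄`-line** (`K` imaginary quadratic, `p = v v̄` split, `κ` unramified outside `v̄`):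
`D_w ⊄ ker κ` for EVERY finite place `w` (-w8 g2 for `w ≠ v̄`; ramification for `w = v̄`). [cite: deShalit1987, Ch. II §1.1] [cite: Lang1990, Ch. 5 §5] -/
theorem decomp_not_le_kerSubgroup_of_isUnramifiedOutside' {p : ℕ} [Fact p.Prime] (hK : IsImaginaryQuadratic K)
    {v vbar : HeightOneSpectrum (𝓞 K)} (hv : ((p : ℕ) : 𝓞 K) ∈ v.asIdeal) (hvbar : ((p : ℕ) : 𝓞 K) ∈ vbar.asIdeal) (hne : vbar ≠ v)
    (κ : ZpExtension K p) (hκ : κ.IsUnramifiedOutside vbar) (w : HeightOneSpectrum (𝓞 K)) :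
    ¬ GreenbergSelmer.decomp w ≤ κ.kerSubgroup := by
  by_cases hw : w = vbar
  · subst hw
    obtain ⟨τ₁, hτ₁, hne1⟩ := exists_mem_inertia_apply_ne_one_of_isUnramifiedOutside hK κ hκ
    exact fun hle ↦ hne1 (ZpExtension.mem_kerSubgroup.mp (hle (GreenbergSelmer.inertia_le_decomp w hτ₁)))
  · exact LineDecomposition.decomp_not_le_kerSubgroup_of_isUnramifiedOutside hK hv hvbar hne κ hκ hw

/-- **`W`-free: on the `v̄`-line EVERY place `w` of `K` has FINITELY many places above it in `K_∞`** — R3's index set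
`D_w \ Γ_K / ker κ` is finite for every `w`, so (LS↑)'s target families over any finite `T` (also `T ∋ v̄`) are finite families.
[cite: NeukirchANT1999, Ch. I §9 p. 54] [cite: deShalit1987, Ch. II §1.1] -/
theorem finite_doubleCosetQuotient_decomp_of_line_all' {p : ℕ} [Fact p.Prime] (hK : IsImaginaryQuadratic K)
    {v vbar : HeightOneSpectrum (𝓞 K)} (hv : ((p : ℕ) : 𝓞 K) ∈ v.asIdeal) (hvbar : ((p : ℕ) : 𝓞 K) ∈ vbar.asIdeal) (hne : vbar ≠ v)
    (κ : ZpExtension K p) (hκ : κ.IsUnramifiedOutside vbar) (w : HeightOneSpectrum (𝓞 K)) :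
    Finite (DoubleCoset.Quotient (GreenbergSelmer.decomp w : Set (absoluteGaloisGroup K)) κ.kerSubgroup) :=
  finite_doubleCosetQuotient_decomp_of_not_le' κ (decomp_not_le_kerSubgroup_of_isUnramifiedOutside' hK hv hvbar hne κ hκ w)

/-- **`W`-free, the other orientation**: `ker κ \ Γ_K / D_w` is finite for every `w`. [cite: NeukirchANT1999, Ch. I §9 p. 54] -/
theorem finite_doubleCosetQuotient_decomp_of_line_all {p : ℕ} [Fact p.Prime] (hK : IsImaginaryQuadratic K)
    {v vbar : HeightOneSpectrum (𝓞 K)} (hv : ((p : ℕ) : 𝓞 K) ∈ v.asIdeal) (hvbar : ((p : ℕ) : 𝓞 K) ∈ vbar.asIdeal) (hne : vbar ≠ v)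
    (κ : ZpExtension K p) (hκ : κ.IsUnramifiedOutside vbar) (w : HeightOneSpectrum (𝓞 K)) :
    Finite (DoubleCoset.Quotient (κ.kerSubgroup : Set (absoluteGaloisGroup K)) (GreenbergSelmer.decomp w)) :=
  finite_doubleCosetQuotient_decomp_of_not_le κ (decomp_not_le_kerSubgroup_of_isUnramifiedOutside' hK hv hvbar hne κ hκ w)

/-- **`W`-free count**: for every `w`, `#(D_w \ Γ_K / ker κ) = p^{m_w}` for the minimal valuation `m_w` of `κ` on `D_w` — the number of places of `K_∞`
above any place of `K` is a power of `p`. [cite: NeukirchANT1999, Ch. I §9 p. 54] [cite: Washington1997, §13.1] -/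
theorem exists_natCard_doubleCosetQuotient_decomp_eq_pow_of_line' {p : ℕ} [Fact p.Prime] (hK : IsImaginaryQuadratic K)
    {v vbar : HeightOneSpectrum (𝓞 K)} (hv : ((p : ℕ) : 𝓞 K) ∈ v.asIdeal) (hvbar : ((p : ℕ) : 𝓞 K) ∈ vbar.asIdeal) (hne : vbar ≠ v)
    (κ : ZpExtension K p) (hκ : κ.IsUnramifiedOutside vbar) (w : HeightOneSpectrum (𝓞 K)) :
    ∃ τ₁ ∈ GreenbergSelmer.decomp w, κ τ₁ ≠ 1 ∧
      Nat.card (DoubleCoset.Quotient (GreenbergSelmer.decomp w : Set (absoluteGaloisGroup K)) κ.kerSubgroup) =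
        p ^ ((κ τ₁).toAdd).valuation := by
  obtain ⟨τ₀, hτ₀, hnot⟩ := SetLike.not_le_iff_exists.mp (decomp_not_le_kerSubgroup_of_isUnramifiedOutside' hK hv hvbar hne κ hκ w)
  obtain ⟨τ₁, hτ₁, hne1, hmin⟩ := exists_mem_minimal_valuation κ (GreenbergSelmer.decomp w) hτ₀
    (fun h ↦ hnot (by rwa [ZpExtension.mem_kerSubgroup]))
  exact ⟨τ₁, hτ₁, hne1, natCard_doubleCosetQuotient_eq' κ (GreenbergSelmer.decomp w) (isClosed_decomp w) hτ₁ hne1 hmin⟩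

end LineAll

end Summit.BirchSwinnertonDyer.BirchSwinnertonDyer.Theorems.PrintCf2.LineDoubleCoset

end
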